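import Literature.Geometry.Riemannian.MassDistribution
import Literature.Geometry.Riemannian.MetricFlowHCenters
import Literature.Geometry.Riemannian.MetricFlowPhi
import HarnessLib

/-!
# Mass distribution on time-slices of an `H`-concentrated metric flow (Bamler 2023, §4.1,
# Proposition)

R. Bamler, *Compactness theory of the space of super Ricci flows*, Invent. Math. 233 (2023), §4.1,
Proposition: *"Let `𝒳` be an `H`-concentrated metric flow over some subset `I ⊂ ℝ`, `r > 0` and let
`(μ_t)_{t ∈ I'}`, `I' ⊂ I`, be a conjugate heat flow on `𝒳` with `sup_{t ∈ I'} Var(μ_t) ≤ V r²`.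
Suppose that `t, t + τ r² ∈ I'` for `τ > 0`. Then
`b^{(𝒳_t, d_t, μ_t)}_r(ε) ≥ ½ Φ(−√(8V/(ε τ)))` if `ε ∈ [2 (τH)^{1/3}, 1]`."*
The printed proof is followed (without rescaling to `r = 1`): with `D := √(2V/ε) r`,
`δ := ½ Φ(−√(8V/(ετ)))`, `t' := t + τ r²`, a point `p ∈ 𝒳_{t'}` with `Var(δ_p, μ_{t'}) ≤ V r²`
has `μ_{t'}(𝒳_{t'} ∖ B(p, D)) ≤ V D⁻² = ε/2` (4.2); an `H`-center `z ∈ 𝒳_t` of `x ∈ 𝒳_{t'}` has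
`ν_{x;t}(𝒳_t ∖ B(z, εr/2)) ≤ (εr/2)⁻² τ H r² ≤ ε/2` (4.3); for the `εr/2`-neighbourhood `Z_{εr/2}`
of the set `Z` of `H`-centers of points of `B(p, D)`, the gradient property (Definition 3.2 (6),
`T = 0`, `u = 𝟙_{B(z', εr)}`) and the reproduction formula give `Z_{εr/2} ⊂ Q_{ε,δ} :=
{μ_t(D(·, εr)) ≥ δ}` (4.4); and again by the reproduction formula
`μ_t(𝒳_t ∖ Z_{εr/2}) ≤ ∫_{B(p,D)} (ε/2) dμ_{t'} + μ_{t'}(𝒳_{t'} ∖ B(p, D)) ≤ ε`.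

* `Phi_zero` — `Φ(0) = ½`;
* `measure_compl_ball_mul_le_lintegral_edist_sq` — Markov's inequality for `d²`;
* `IsHConcentrated.measure_thinSet_slice_le` — **the Proposition** as
  `μ_t({x : μ_t(D(x, εr)) < δ}) ≤ ε`;
* `IsHConcentrated.le_massDistribution_slice` — **`b^{(𝒳_t, d_t, μ_t)}_r(ε) ≥ δ`**.

We assume `V > 0` (the printed `V D⁻²` requires `D > 0`; the bound is monotone in `V`).
Everything is proved; no definitions, no named facts.

## References

* R. H. Bamler, *Compactness theory of the space of super Ricci flows*, Invent. Math. 233 (2023),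
  §4.1, Proposition (mass distribution on time-slices), proof, (4.1)–(4.4). [Bamler2023]
-/

noncomputable section

open Set MeasureTheory Filter Topology Metric Function ProbabilityTheory
open scoped ENNReal NNReal

namespace Literature.Geometry.Riemannian

/-! ### `Φ(0) = ½` -/

namespace MetricFlow

/-- **`Φ(0) = ½`**: the centred Gaussian is symmetric and has no atoms.
[cite: Bamler2023, §3, (3.1)] -/
theorem Phi_zero : Phi 0 = 1 / 2 := by
  set γ : Measure ℝ := gaussianReal 0 2 with hγ
  have hsymm : γ.map (fun x ↦ -x) = γ := by rw [hγ, gaussianReal_map_neg, neg_zero]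
  have hIic : γ (Iic 0) = γ (Ici 0) := by
    conv_lhs => rw [← hsymm]
    rw [Measure.map_apply measurable_neg measurableSet_Iic]
    congr 1
    ext x
    simp
  haveI : NullSingletonClass γ := nullSingletonClass_gaussianReal two_ne_zero
  have hnull : γ {0} = 0 := measure_singleton 0
  have hIci : γ (Ici 0) = γ (Ioi 0) := by
    refine le_antisymm ?_ (measure_mono Ioi_subset_Ici_self)
    calc γ (Ici 0) ≤ γ ({0} ∪ Ioi 0) := measure_mono fun x hx ↦ by
          rcases (mem_Ici.1 hx).eq_or_lt with h | h
          · exact Or.inl h.symm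
          · exact Or.inr h
      _ ≤ γ {0} + γ (Ioi 0) := measure_union_le _ _
      _ = γ (Ioi 0) := by rw [hnull, zero_add]
  have hsum : γ (Iic 0) + γ (Ioi 0) = 1 := by
    rw [← measure_union (Iic_disjoint_Ioi le_rfl) measurableSet_Ioi, Iic_union_Ioi, measure_univ]
  have htwo : 2 * γ (Iic 0) = 1 := by rw [two_mul]; nth_rw 2 [hIic]; rw [hIci]; exact hsum
  have hval : γ (Iic 0) = 1 / 2 := by
    rw [ENNReal.eq_div_iff (by norm_num) (by norm_num)]
    exact htwo
  rw [Phi, cdf_eq_real, measureReal_def, ← hγ, hval, ENNReal.toReal_div, ENNReal.toReal_one]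
  norm_num

end MetricFlow

/-! ### Markov's inequality for `d²` -/

section Markov

variable {X : Type*} [MetricSpace X] [MeasurableSpace X] [OpensMeasurableSpace X]

/-- **Markov**: `ρ² ν(X ∖ B(z, ρ)) ≤ ∫ d²(z, ·) dν` for `ρ ≥ 0`. [folklore] -/
theorem measure_compl_ball_mul_le_lintegral_edist_sq (ν : Measure X) (z : X) {ρ : ℝ} (hρ : 0 ≤ ρ) :
    ENNReal.ofReal (ρ ^ 2) * ν (ball z ρ)ᶜ ≤ ∫⁻ y, edist z y ^ 2 ∂ν := by
  calc ENNReal.ofReal (ρ ^ 2) * ν (ball z ρ)ᶜ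
      = ∫⁻ _ in (ball z ρ)ᶜ, ENNReal.ofReal (ρ ^ 2) ∂ν := by rw [setLIntegral_const]
    _ ≤ ∫⁻ y in (ball z ρ)ᶜ, edist z y ^ 2 ∂ν := by
        refine setLIntegral_mono' measurableSet_ball.compl fun y hy ↦ ?_
        rw [mem_compl_iff, mem_ball, not_lt, dist_comm] at hy
        rw [edist_dist, ← ENNReal.ofReal_pow dist_nonneg]
        exact ENNReal.ofReal_le_ofReal (pow_le_pow_left₀ hρ hy 2)
    _ ≤ ∫⁻ y, edist z y ^ 2 ∂ν := setLIntegral_le_lintegral _ _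

/-- Markov in the form `ν(X ∖ B(z, ρ)) ≤ V/ρ²` when `∫ d²(z, ·) dν ≤ V`, `ρ > 0`. [folklore] -/
theorem measure_compl_ball_le_div (ν : Measure X) (z : X) {ρ V : ℝ} (hρ : 0 < ρ)
    (hV : ∫⁻ y, edist z y ^ 2 ∂ν ≤ ENNReal.ofReal V) :
    ν (ball z ρ)ᶜ ≤ ENNReal.ofReal (V / ρ ^ 2) := by
  have h := (measure_compl_ball_mul_le_lintegral_edist_sq ν z hρ.le).trans hV
  have hρ2 : 0 < ρ ^ 2 := by positivity
  rw [mul_comm, ← ENNReal.le_div_iff_mul_le (Or.inl ((ENNReal.ofReal_pos.2 hρ2).ne'))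
    (Or.inl ENNReal.ofReal_ne_top)] at h
  rwa [← ENNReal.ofReal_div_of_pos hρ2] at h

end Markov

/-! ### The Proposition -/

namespace MetricFlow

universe u

variable {I : Set ℝ} {𝒳 : MetricFlow.{u} I} {H : ℝ}

/-- The printed range `ε ≥ 2 (τH)^{1/3}` in the form used in the proof: `8 τ H ≤ ε³`.
[cite: Bamler2023, §4.1, Proposition (mass distribution on time-slices)] -/
theorem eight_mul_le_pow_three_of_le {τ H ε : ℝ} (hτH : 0 ≤ τ * H)
    (hε : 2 * (τ * H) ^ (1 / 3 : ℝ) ≤ ε) : 8 * (τ * H) ≤ ε ^ 3 := by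
  have h0 : 0 ≤ (τ * H) ^ (1 / 3 : ℝ) := Real.rpow_nonneg hτH _
  have h1 : ((τ * H) ^ (1 / 3 : ℝ)) ^ 3 = τ * H := by
    rw [show (1 / 3 : ℝ) = ((3 : ℕ) : ℝ)⁻¹ by norm_num]
    exact Real.rpow_inv_natCast_pow hτH three_ne_zero
  have h2 : (2 * (τ * H) ^ (1 / 3 : ℝ)) ^ 3 ≤ ε ^ 3 := pow_le_pow_left₀ (by positivity) hε 3
  nlinarith [h1, h2]

/-- **Mass distribution on time-slices** (Bamler 2023, §4.1, Proposition), in the form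
`μ_t({x : μ_t(D(x, εr)) < δ}) ≤ ε` with `δ = ½ Φ(−√(8V/(ετ)))`: for an `H`-concentrated metric flow,
a conjugate heat flow `(μ_t)_{t ∈ I'}` with `Var(μ_{t'}) ≤ V r²` at `t' = t + τ r² ∈ I'` (`τ > 0`,
`V > 0`) and `ε ∈ (0, 1]` with `8 τ H ≤ ε³` (i.e. `ε ≥ 2(τH)^{1/3}`,
`eight_mul_le_pow_three_of_le`). Printed proof, (4.1)–(4.4).
[cite: Bamler2023, §4.1, Proposition (mass distribution on time-slices)] -/
theorem IsHConcentrated.measure_thinSet_slice_le (hH : 𝒳.IsHConcentrated H)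
    {I' : Set ℝ} {μ : ∀ t : I, Measure (𝒳.Slice t)} (hμ : 𝒳.IsConjugateHeatFlow I' μ)
    {t t' : I} (ht : (t : ℝ) ∈ I') (ht' : (t' : ℝ) ∈ I') {r τ V ε : ℝ} (hr : 0 < r) (hτ : 0 < τ)
    (htt' : (t' : ℝ) = t + τ * r ^ 2) (hV0 : 0 < V)
    (hV : variance (μ t') (μ t') ≤ ENNReal.ofReal (V * r ^ 2)) (hε0 : 0 < ε) (hε1 : ε ≤ 1)
    (hε : 8 * (τ * H) ≤ ε ^ 3) :
    μ t (thinSet (μ t) (ε * r) (ENNReal.ofReal (Phi (-Real.sqrt (8 * V / (ε * τ))) / 2))) ≤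
      ENNReal.ofReal ε := by
  haveI := hμ.1 t ht
  haveI := hμ.1 t' ht'
  have hlt : (t : ℝ) < t' := by rw [htt']; linarith [mul_pos hτ (pow_pos hr 2)]
  have hle : (t : ℝ) ≤ t' := hlt.le
  have hdiff : (t' : ℝ) - t = τ * r ^ 2 := by rw [htt']; ring
  haveI : ∀ y : 𝒳.Slice t', IsProbabilityMeasure (𝒳.condKernel y t) := fun y ↦
    𝒳.isProbabilityMeasure_condKernel y hle
  set ρ := ε * r with hρ
  have hρ0 : 0 < ρ := mul_pos hε0 hr
  set D := Real.sqrt (2 * V / ε) * r with hD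
  have hD0 : 0 < D := mul_pos (Real.sqrt_pos.2 (by positivity)) hr
  set a := Real.sqrt (8 * V / (ε * τ)) with ha
  have ha0 : 0 ≤ a := Real.sqrt_nonneg _
  have ha2 : a = 2 * Real.sqrt (2 * V / ε) / Real.sqrt τ := by
    rw [ha, show 8 * V / (ε * τ) = 4 * ((2 * V / ε) / τ) by field_simp; ring,
      Real.sqrt_mul (by norm_num : (0 : ℝ) ≤ 4), Real.sqrt_div (by positivity : 0 ≤ 2 * V / ε),
      show Real.sqrt 4 = 2 by rw [show (4 : ℝ) = 2 ^ 2 by norm_num, Real.sqrt_sq (by norm_num)]]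
    ring
  set δr := Phi (-a) / 2 with hδr
  have hPhi0 : 0 ≤ Phi (-a) := (Phi_mem_Icc (-a)).1
  -- a lower bound `1/2 ≤ 1 − ε/2` in `[0, ∞]`
  have hhalf : ENNReal.ofReal (1 / 2) ≤ 1 - ENNReal.ofReal (ε / 2) := by
    rw [← ENNReal.ofReal_one, ← ENNReal.ofReal_sub _ (by positivity)]
    exact ENNReal.ofReal_le_ofReal (by linarith)
  -- Step 1: the point `p` and (4.2)
  obtain ⟨p, hp⟩ : ∃ p : 𝒳.Slice t', ∫⁻ y, edist p y ^ 2 ∂(μ t') ≤ ENNReal.ofReal (V * r ^ 2) := by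
    have hmeas : Measurable fun z : 𝒳.Slice t' ↦ ∫⁻ y, edist z y ^ 2 ∂(μ t') :=
      (measurable_edist.pow_const 2).lintegral_prod_right'
    obtain ⟨p, h⟩ := exists_le_lintegral (μ := μ t') hmeas.aemeasurable
    exact ⟨p, h.trans (by rw [← variance_def]; exact hV)⟩
  have hpD : μ t' (ball p D)ᶜ ≤ ENNReal.ofReal (ε / 2) := by
    refine (measure_compl_ball_le_div (μ t') p hD0 hp).trans_eq ?_
    congr 1
    rw [hD, mul_pow, Real.sq_sqrt (by positivity : (0 : ℝ) ≤ 2 * V / ε)]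
    field_simp
  have hball : ENNReal.ofReal (1 / 2) ≤ μ t' (ball p D) := by
    have h1 : μ t' (ball p D) + μ t' (ball p D)ᶜ = 1 := by
      rw [measure_add_measure_compl measurableSet_ball, measure_univ]
    refine hhalf.trans ?_
    rw [← h1]
    exact tsub_le_iff_right.2 (add_le_add le_rfl hpD)
  -- Step 2: (4.3) `ν_{x;t}(𝒳_t ∖ B(z, ρ/2)) ≤ ε/2` for an `H`-center `z` of `x`
  have hcenter : ∀ (x : 𝒳.Slice t') (z : 𝒳.Slice t), 𝒳.IsHCenter H z x →
      𝒳.condKernel x t (ball z (ρ / 2))ᶜ ≤ ENNReal.ofReal (ε / 2) := by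
    intro x z hz
    have hvar : ∫⁻ y, edist z y ^ 2 ∂(𝒳.condKernel x t) ≤ ENNReal.ofReal (H * (τ * r ^ 2)) := by
      rw [← variance_dirac_left, ← hdiff]
      exact hz.2
    refine (measure_compl_ball_le_div _ z (half_pos hρ0) hvar).trans (ENNReal.ofReal_le_ofReal ?_)
    rw [hρ, div_le_iff₀ (by positivity)]
    nlinarith [mul_nonneg (sub_nonneg.2 hε) (sq_nonneg r)]
  -- Step 3: `Z`, its `ρ/2`-neighbourhood, and (4.4)
  set Z : Set (𝒳.Slice t) := {z | ∃ x ∈ ball p D, 𝒳.IsHCenter H z x} with hZ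
  set Zn : Set (𝒳.Slice t) := thickening (ρ / 2) Z with hZn
  have hZn_open : IsOpen Zn := isOpen_thickening
  have hA : ∀ z' ∈ Zn, ENNReal.ofReal δr ≤ μ t (ball z' ρ) := by
    intro z' hz'
    obtain ⟨z, ⟨x, hx, hzx⟩, hzz'⟩ := mem_thickening_iff.1 hz'
    set S : Set (𝒳.Slice t) := ball z' ρ with hS
    have hSm : MeasurableSet S := measurableSet_ball
    have hsub : ball z (ρ / 2) ⊆ S := fun y hy ↦ by
      rw [hS, mem_ball]
      rw [mem_ball] at hy
      linarith [dist_triangle y z z', dist_comm z' z]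
    -- `ν_{x;t}(S) ≥ 1/2`
    have hνx : ENNReal.ofReal (1 / 2) ≤ 𝒳.condKernel x t S := by
      have h1 : 𝒳.condKernel x t (ball z (ρ / 2)) + 𝒳.condKernel x t (ball z (ρ / 2))ᶜ = 1 := by
        rw [measure_add_measure_compl measurableSet_ball, measure_univ]
      calc ENNReal.ofReal (1 / 2) ≤ 1 - ENNReal.ofReal (ε / 2) := hhalf
        _ ≤ 𝒳.condKernel x t (ball z (ρ / 2)) := by
            rw [← h1]
            exact tsub_le_iff_right.2 (add_le_add le_rfl (hcenter x z hzx))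
        _ ≤ 𝒳.condKernel x t S := measure_mono hsub
    have hxreal : 1 / 2 ≤ (𝒳.condKernel x t).real S := by
      rw [measureReal_def]
      exact (ENNReal.ofReal_le_iff_le_toReal (measure_ne_top _ _)).1 hνx
    -- the gradient property with `u = 𝟙_S`, `T = 0`
    set u : 𝒳.Slice t → ℝ := S.indicator 1 with hu
    have hum : Measurable u := measurable_one.indicator hSm
    have hu01 : ∀ y, u y ∈ Icc (0 : ℝ) 1 := by
      intro y
      by_cases hy : y ∈ S <;> simp [hu, hy]
    have key := 𝒳.gradient_property hlt 0 le_rfl u hum hu01 (fun h0 ↦ (lt_irrefl _ h0).elim)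
    have hint : ∀ y : 𝒳.Slice t', ∫ w, u w ∂(𝒳.condKernel y t) = (𝒳.condKernel y t).real S :=
      fun y ↦ integral_indicator_one hSm
    have hlow : ∀ y ∈ ball p D, Phi (-a) ≤ (𝒳.condKernel y t).real S := by
      intro y hy
      rcases key with ⟨c, hc⟩ | ⟨f', hf', hf'eq⟩
      · have : (𝒳.condKernel y t).real S = (𝒳.condKernel x t).real S := by
          rw [← hint y, ← hint x, hc y, hc x]
        rw [this]
        calc Phi (-a) ≤ Phi 0 := Phi_mono (by linarith)
          _ = 1 / 2 := Phi_zero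
          _ ≤ _ := hxreal
      · have hfx : 0 ≤ f' x := by
          have h1 : Phi 0 ≤ Phi (f' x) := by
            rw [Phi_zero, ← hf'eq x, hint x]
            exact hxreal
          exact Phi_strictMono.le_iff_le.1 h1
        have hdxy : dist x y < 2 * D := by
          rw [mem_ball] at hx hy
          linarith [dist_triangle x p y, dist_comm p y]
        have hLip := hf'.dist_le_mul x y
        have hK : ((Real.toNNReal (1 / Real.sqrt ((t' : ℝ) - t + 0)) : ℝ≥0) : ℝ) =
            1 / (Real.sqrt τ * r) := by
          rw [add_zero, hdiff, Real.coe_toNNReal _ (by positivity), Real.sqrt_mul hτ.le,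
            Real.sqrt_sq hr.le]
        rw [hK, Real.dist_eq] at hLip
        have h3 : 1 / (Real.sqrt τ * r) * dist x y ≤ 1 / (Real.sqrt τ * r) * (2 * D) :=
          mul_le_mul_of_nonneg_left hdxy.le (by positivity)
        have h4 : 1 / (Real.sqrt τ * r) * (2 * D) = a := by
          rw [ha2, hD]
          field_simp
        have hfy : -a ≤ f' y := by
          have := (abs_sub_le_iff.1 hLip).1
          linarith
        calc Phi (-a) ≤ Phi (f' y) := Phi_mono hfy
          _ = (𝒳.condKernel y t).real S := by rw [← hf'eq y, hint y]
    -- the reproduction formula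
    have hrep : μ t S = ∫⁻ y, 𝒳.condKernel y t S ∂(μ t') := hμ.2 ht ht' hle S hSm
    calc ENNReal.ofReal δr = ENNReal.ofReal (Phi (-a)) * ENNReal.ofReal (1 / 2) := by
          rw [← ENNReal.ofReal_mul hPhi0, hδr, mul_one_div]
      _ ≤ ENNReal.ofReal (Phi (-a)) * μ t' (ball p D) := by gcongr
      _ = ∫⁻ _ in ball p D, ENNReal.ofReal (Phi (-a)) ∂(μ t') := (setLIntegral_const _ _).symm
      _ ≤ ∫⁻ y in ball p D, 𝒳.condKernel y t S ∂(μ t') := by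
          refine setLIntegral_mono' measurableSet_ball fun y hy ↦ ?_
          rw [← ENNReal.ofReal_toReal (measure_ne_top _ S), ← measureReal_def]
          exact ENNReal.ofReal_le_ofReal (hlow y hy)
      _ ≤ ∫⁻ y, 𝒳.condKernel y t S ∂(μ t') := setLIntegral_le_lintegral _ _
      _ = μ t S := hrep.symm
  -- Step 4: the thin set avoids `Zn`, and `μ_t(𝒳_t ∖ Zn) ≤ ε`
  have hthin_sub : thinSet (μ t) ρ (ENNReal.ofReal δr) ⊆ Znᶜ := by
    intro z' hz' hmem
    rw [mem_thinSet] at hz'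
    exact absurd hz' (not_lt.2 ((hA z' hmem).trans (measure_mono ball_subset_closedBall)))
  have hZnc : μ t Znᶜ ≤ ENNReal.ofReal ε := by
    have hrep : μ t Znᶜ = ∫⁻ x, 𝒳.condKernel x t Znᶜ ∂(μ t') :=
      hμ.2 ht ht' hle _ hZn_open.measurableSet.compl
    rw [hrep, ← lintegral_add_compl _ (measurableSet_ball (x := p) (ε := D))]
    calc ∫⁻ x in ball p D, 𝒳.condKernel x t Znᶜ ∂(μ t') +
          ∫⁻ x in (ball p D)ᶜ, 𝒳.condKernel x t Znᶜ ∂(μ t')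
        ≤ ∫⁻ _ in ball p D, ENNReal.ofReal (ε / 2) ∂(μ t') + ∫⁻ _ in (ball p D)ᶜ, 1 ∂(μ t') := by
          refine add_le_add (setLIntegral_mono' measurableSet_ball fun x hx ↦ ?_)
            (setLIntegral_mono' measurableSet_ball.compl fun x _ ↦ prob_le_one)
          obtain ⟨z, hz⟩ := hH.exists_isHCenter hle x
          have hzZ : z ∈ Z := ⟨x, hx, hz⟩
          have hsub : ball z (ρ / 2) ⊆ Zn := fun y hy ↦
            mem_thickening_iff.2 ⟨z, hzZ, mem_ball.1 hy⟩
          calc 𝒳.condKernel x t Znᶜ ≤ 𝒳.condKernel x t (ball z (ρ / 2))ᶜ :=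
                measure_mono (compl_subset_compl.2 hsub)
            _ ≤ ENNReal.ofReal (ε / 2) := hcenter x z hz
      _ = ENNReal.ofReal (ε / 2) * μ t' (ball p D) + μ t' (ball p D)ᶜ := by
          rw [setLIntegral_const, setLIntegral_const, one_mul]
      _ ≤ ENNReal.ofReal (ε / 2) * 1 + ENNReal.ofReal (ε / 2) := by
          gcongr
          · exact prob_le_one
      _ = ENNReal.ofReal ε := by
          rw [mul_one, ← ENNReal.ofReal_add (by positivity) (by positivity), add_halves]
  exact (measure_mono hthin_sub).trans hZnc

/-- **`b^{(𝒳_t, d_t, μ_t)}_r(ε) ≥ ½ Φ(−√(8V/(ετ)))`** (Bamler 2023, §4.1, Proposition), for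
`ε ∈ (0, 1]` with `8 τ H ≤ ε³`, under the hypotheses of `measure_thinSet_slice_le`.
[cite: Bamler2023, §4.1, Proposition (mass distribution on time-slices)] -/
theorem IsHConcentrated.le_massDistribution_slice (hH : 𝒳.IsHConcentrated H)
    {I' : Set ℝ} {μ : ∀ t : I, Measure (𝒳.Slice t)} (hμ : 𝒳.IsConjugateHeatFlow I' μ)
    {t t' : I} (ht : (t : ℝ) ∈ I') (ht' : (t' : ℝ) ∈ I') {r τ V ε : ℝ} (hr : 0 < r) (hτ : 0 < τ)
    (htt' : (t' : ℝ) = t + τ * r ^ 2) (hV0 : 0 < V)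
    (hV : variance (μ t') (μ t') ≤ ENNReal.ofReal (V * r ^ 2)) (hε0 : 0 < ε) (hε1 : ε ≤ 1)
    (hε : 8 * (τ * H) ≤ ε ^ 3) :
    ENNReal.ofReal (Phi (-Real.sqrt (8 * V / (ε * τ))) / 2) ≤ massDistribution (μ t) r ε := by
  have hle1 : ENNReal.ofReal (Phi (-Real.sqrt (8 * V / (ε * τ))) / 2) ≤ 1 :=
    ENNReal.ofReal_le_one.2 (by linarith [(Phi_mem_Icc (-Real.sqrt (8 * V / (ε * τ)))).2])
  rw [le_massDistribution_iff _ _ _ hle1]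
  exact hH.measure_thinSet_slice_le hμ ht ht' hr hτ htt' hV0 hV hε0 hε1 hε

end MetricFlow

end Literature.Geometry.Riemannian

end
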